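import Literature.NumberTheory.Irrationality.Zudilin2004.Lemma19Coefficients
import Literature.NumberTheory.Transcendental.ZudilinLinearForm
import HarnessLib

/-!
# Zudilin 2004, Lemma 19 for general `𝐡`, IV: the series `F(𝐡)` as a linear form in odd zeta values

Topic `Literature/NumberTheory/Irrationality/Zudilin2004`. Fourth file of the discharge of
`Literature.NumberTheory.Irrationality.Zudilin2004.lemma19`, following [Zudilin2004, §8, proof of Lemma 19]
(arXiv:math/0206176 p. 20): the real-analytic half. For a valid parameter set `P`:

* `HParams.Rwp_eq_div` — `R(t)` as a quotient of real polynomials, whence continuity off the poles and the decay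
  `t R(t) → 0` (8.3) (`HParams.tendsto_mul_Rwp`, from `deg num + 2 ≤ deg den`, i.e. (8.1));
* `HParams.Rwp_eq_pfSumR` — the partial fractions `R(t) = Σ_k Σ_s B_{s,k} (t+k)^{−s}` over `ℝ` for
  `t > −h_{r+1}` (from the rational identity of `Lemma19Coefficients.lean` by density and continuity);
* `HParams.sum_B_one_eq_zero` — the residues sum to zero, `Σ_k B P 1 k = 0` (printed: `A_r = 0` by (8.3));
* `HParams.iteratedDeriv_Rwp` — `R^{(m)}(t) = Σ_k Σ_s B_{s,k} (−1)^m s(s+1)⋯(s+m−1) (t+k)^{−s−m}`;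
* `HParams.Fwp_eq` — **the linear form**: with `qZeta P s = C(s+r−2, r−1) Σ_k B P s k` and the rational constant
  `qConst P = −Σ_k Σ_{s=1}^{q−r} C(s+r−2, r−1) B P s k H_{k−h₁}^{(s+r−1)}` (`H_i^{(m)} = Σ_{l≤i} l^{−m}`),
  `F(𝐡) = Σ_{s=2}^{q−r} qZeta P s · ζ(s+r−1) + qConst P`
  (printed: `F(𝐡) = Σ_j A_{j−1} ζ(j−1) − A_0`, (8.12)). The summation is uniform in odd `r ≥ 1`: the `s = 1` group
  `Σ_k B_{1,k} (t+k)^{−r}` is summed as `Σ_k B_{1,k}((t+k)^{−r} − (t+h_{r+1})^{−r})` (legitimate since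
  `Σ_k B_{1,k} = 0`), a non-negative telescoping series even when `r = 1` (`HParams.hasSum_sub_shift`).

Everything here is PROVED (no named facts).

## References

* [Zudilin2004] W. Zudilin, *Arithmetic of linear forms involving odd zeta values*, J. Théor. Nombres Bordeaux
  16 (2004), 251–291 = arXiv:math/0206176, §8 (8.3), (8.6), proof of Lemma 19 ((8.12)).
-/

noncomputable section

open Finset Filter Topology Polynomial Literature.Analysis.Calculus
open scoped Nat

namespace Literature.NumberTheory.Irrationality.Zudilin2004

open Literature.NumberTheory.Transcendental
open Literature.NumberTheory.Transcendental.Zudilin2004 (Hsum hasSum_inv_pow_shift tendsto_mul_inv_pow)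

namespace HParams

variable (P : HParams)

/-! ### `R(t)` as a quotient of real polynomials -/

/-- The numerator of `R(t)` as a real polynomial (cf. `HParams.numPoly`). [cite: Zudilin2004, §8 (8.7)] -/
def numPolyR : ℝ[X] :=
  (C 2 * X + C (P.h 0 : ℝ)) *
    (∏ j ∈ Icc 1 P.r, (∏ i ∈ Icc 1 (P.h j - 1), (X + C (i : ℝ))) * C (((P.h j - 1)! : ℝ)⁻¹)) *
    (∏ j ∈ Icc 1 P.r,
      (∏ i ∈ Icc 1 (P.h j - 1), (X + C ((P.h 0 - P.h j : ℕ) : ℝ) + C (i : ℝ))) * C (((P.h j - 1)! : ℝ)⁻¹)) *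
    C (∏ j ∈ Icc (P.r + 1) P.q, ((P.h 0 - 2 * P.h j)! : ℝ))

/-- The denominator `∏_{j>r} ∏_{i=0}^{h₀−2h_j} (X + h_j + i)` of `R(t)` as a real polynomial. [cite: Zudilin2004, §8 (8.7)] -/
def denPolyR : ℝ[X] :=
  ∏ j ∈ Icc (P.r + 1) P.q, ∏ i ∈ Icc 0 (P.h 0 - 2 * P.h j), (X + C (P.h j : ℝ) + C (i : ℝ))

/-- `deg numPolyR ≤ 1 + 2 Σ_{j≤r} (h_j − 1)`. [cite: Zudilin2004, §8 (8.3)] -/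
theorem natDegree_numPolyR_le :
    P.numPolyR.natDegree ≤ 1 + (∑ j ∈ Icc 1 P.r, (P.h j - 1)) + ∑ j ∈ Icc 1 P.r, (P.h j - 1) := by
  unfold numPolyR
  have h1 : (C (2 : ℝ) * X + C (P.h 0 : ℝ)).natDegree ≤ 1 := natDegree_linear_le
  have hA : (∏ j ∈ Icc 1 P.r, (∏ i ∈ Icc 1 (P.h j - 1), (X + C (i : ℝ))) * C (((P.h j - 1)! : ℝ)⁻¹)).natDegree
      ≤ ∑ j ∈ Icc 1 P.r, (P.h j - 1) := by
    refine (natDegree_prod_le _ _).trans (sum_le_sum fun j _ => ?_)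
    refine (natDegree_mul_C_le _ _).trans ((natDegree_prod_le _ _).trans ?_)
    simp only [natDegree_X_add_C, sum_const, smul_eq_mul, mul_one, Nat.card_Icc]
    omega
  have hB : (∏ j ∈ Icc 1 P.r, (∏ i ∈ Icc 1 (P.h j - 1), (X + C ((P.h 0 - P.h j : ℕ) : ℝ) + C (i : ℝ))) *
      C (((P.h j - 1)! : ℝ)⁻¹)).natDegree ≤ ∑ j ∈ Icc 1 P.r, (P.h j - 1) := by
    refine (natDegree_prod_le _ _).trans (sum_le_sum fun j _ => ?_)
    refine (natDegree_mul_C_le _ _).trans ((natDegree_prod_le _ _).trans ?_)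
    have : ∀ i ∈ Icc 1 (P.h j - 1), (X + C ((P.h 0 - P.h j : ℕ) : ℝ) + C (i : ℝ)).natDegree = 1 := by
      intro i _
      rw [add_assoc, ← C_add, natDegree_X_add_C]
    rw [sum_congr rfl this]
    simp only [sum_const, smul_eq_mul, mul_one, Nat.card_Icc]
    omega
  exact ((natDegree_mul_C_le _ _).trans (natDegree_mul_le.trans (add_le_add (natDegree_mul_le.trans
    (add_le_add h1 hA)) hB))).trans le_rfl

/-- `deg denPolyR = Σ_{j>r} (h₀ − 2h_j + 1)`. [cite: Zudilin2004, §8 (8.7)] -/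
theorem natDegree_denPolyR : P.denPolyR.natDegree = ∑ j ∈ Icc (P.r + 1) P.q, (P.h 0 - 2 * P.h j + 1) := by
  unfold denPolyR
  have hmon : ∀ (j i : ℕ), (X + C (P.h j : ℝ) + C (i : ℝ)).Monic := fun j i => by
    rw [add_assoc, ← C_add]; exact monic_X_add_C _
  have hdeg : ∀ (j i : ℕ), (X + C (P.h j : ℝ) + C (i : ℝ)).natDegree = 1 := fun j i => by
    rw [add_assoc, ← C_add, natDegree_X_add_C]
  rw [natDegree_prod_of_monic _ _ fun j _ => monic_prod_of_monic _ _ fun i _ => hmon j i]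
  refine sum_congr rfl fun j _ => ?_
  rw [natDegree_prod_of_monic _ _ fun i _ => hmon j i, sum_congr rfl fun i _ => hdeg j i, sum_const,
    smul_eq_mul, mul_one, Nat.card_Icc]
  omega

variable {P} in
/-- (8.1) in the form `deg num + 3 ≤ deg den`. [cite: Zudilin2004, §8 (8.1), (8.3)] -/
theorem sum_numDeg_add_two_le (hV : P.Valid) :
    1 + (∑ j ∈ Icc 1 P.r, (P.h j - 1)) + (∑ j ∈ Icc 1 P.r, (P.h j - 1)) + 2
      ≤ ∑ j ∈ Icc (P.r + 1) P.q, (P.h 0 - 2 * P.h j + 1) := by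
  have h := natDegree_add_two_le_length hV
  rw [length_denList] at h
  -- we redo the arithmetic of `natDegree_add_two_le_length` for the explicit bound
  have hrq := hV.r_add_four_le
  have h81 := hV.two_mul_sum_le
  have hS1 : ∑ j ∈ Icc 1 P.r, (P.h j - 1) = (∑ j ∈ Icc 1 P.r, P.h j) - P.r := by
    rw [sum_tsub_distrib _ fun j hj => hV.one_le_h (j := j) (by have := mem_Icc.1 hj; omega)]
    simp
  have hS2 : ∑ j ∈ Icc (P.r + 1) P.q, (P.h 0 - 2 * P.h j + 1)
      = (P.q - P.r) * (P.h 0 + 1) - ∑ j ∈ Icc (P.r + 1) P.q, 2 * P.h j := by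
    have e : ∀ j ∈ Icc (P.r + 1) P.q, P.h 0 - 2 * P.h j + 1 = (P.h 0 + 1) - 2 * P.h j := by
      intro j hj
      have := hV.two_mul_h_lt (j := j) (by have := mem_Icc.1 hj; omega) (mem_Icc.1 hj).2
      omega
    rw [sum_congr rfl e, sum_tsub_distrib _ fun j hj =>
      (hV.two_mul_h_lt (j := j) (by have := mem_Icc.1 hj; omega) (mem_Icc.1 hj).2).le.trans (by omega)]
    simp only [sum_const, smul_eq_mul, Nat.card_Icc]
    congr 1
    rw [show P.q + 1 - (P.r + 1) = P.q - P.r by omega]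
  have hsplit : ∑ j ∈ Icc 1 P.q, P.h j = ∑ j ∈ Icc 1 P.r, P.h j + ∑ j ∈ Icc (P.r + 1) P.q, P.h j := by
    rw [← sum_union]
    · congr 1
      ext j
      simp only [mem_Icc, mem_union]
      omega
    · rw [disjoint_left]
      intro j hj hj'
      have := mem_Icc.1 hj
      have := mem_Icc.1 hj'
      omega
  have hr1 : P.r ≤ ∑ j ∈ Icc 1 P.r, P.h j := by
    have := sum_le_sum (s := Icc 1 P.r) (f := fun _ => 1) (g := fun j => P.h j)
      fun j hj => hV.one_le_h (j := j) (by have := mem_Icc.1 hj; omega)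
    simpa using this
  have h2 : ∑ j ∈ Icc (P.r + 1) P.q, 2 * P.h j = 2 * ∑ j ∈ Icc (P.r + 1) P.q, P.h j := by
    rw [mul_sum]
  rw [hS1, hS2, h2]
  rw [hsplit] at h81
  have e3 : (P.q - P.r) * (P.h 0 + 1) = P.h 0 * (P.q - P.r) + (P.q - P.r) := by ring
  rw [e3]
  omega

/-- `R(t) = numPolyR(t) / denPolyR(t)` for every real `t` (also at the poles, where both sides are `0`).
[cite: Zudilin2004, §8 (8.7)] -/
theorem Rwp_eq_div (t : ℝ) : P.Rwp t = P.numPolyR.eval t / P.denPolyR.eval t := by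
  unfold Rwp numPolyR denPolyR
  simp only [eval_mul, eval_C, eval_add, eval_X, eval_prod]
  simp only [div_eq_mul_inv, prod_mul_distrib, prod_inv_distrib]
  ring

variable {P}

/-- `t + k > 0` for `t > −h_{r+1}` and a pole index `k`. [cite: Zudilin2004, §8 Lemma 19 (proof)] -/
theorem pos_of_mem_poleSet {t : ℝ} (ht : -(P.h (P.r + 1) : ℝ) < t) {k : ℕ} (hk : k ∈ P.poleSet) :
    0 < t + k := by
  have := (mem_Icc.1 hk).1
  have : (P.h (P.r + 1) : ℝ) ≤ k := by exact_mod_cast this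
  linarith

/-- `denPolyR(t) > 0` for `t > −h_{r+1}`. [cite: Zudilin2004, §8 Lemma 19 (proof)] -/
theorem denPolyR_eval_pos (hV : P.Valid) {t : ℝ} (ht : -(P.h (P.r + 1) : ℝ) < t) : 0 < P.denPolyR.eval t := by
  have hrq := hV.r_add_four_le
  unfold denPolyR
  simp only [eval_prod, eval_add, eval_X, eval_C]
  refine prod_pos fun j hj => prod_pos fun i _ => ?_
  have hjr : P.h (P.r + 1) ≤ P.h j := hV.h_mono (by omega) (mem_Icc.1 hj).1 (mem_Icc.1 hj).2
  have h1 : (P.h (P.r + 1) : ℝ) ≤ P.h j := by exact_mod_cast hjr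
  have h2 : (0 : ℝ) ≤ i := Nat.cast_nonneg i
  linarith

/-- Continuity of `R` at `t > −h_{r+1}`. [cite: Zudilin2004, §8 Lemma 19 (proof)] -/
theorem continuousAt_Rwp (hV : P.Valid) {t : ℝ} (ht : -(P.h (P.r + 1) : ℝ) < t) : ContinuousAt P.Rwp t := by
  have h : P.Rwp = fun t => P.numPolyR.eval t / P.denPolyR.eval t := funext P.Rwp_eq_div
  rw [h]
  exact P.numPolyR.continuousAt.div P.denPolyR.continuousAt (denPolyR_eval_pos hV ht).ne'

/-- **Decay (8.3)**: `t R(t) → 0` as `t → ∞`. [cite: Zudilin2004, §8 (8.3)] -/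
theorem tendsto_mul_Rwp (hV : P.Valid) : Tendsto (fun t : ℝ => t * P.Rwp t) atTop (𝓝 0) := by
  have hdeg : (X * P.numPolyR).degree < P.denPolyR.degree := by
    refine degree_lt_degree ?_
    have h1 : (X * P.numPolyR).natDegree ≤ 1 + P.numPolyR.natDegree :=
      natDegree_mul_le.trans (by rw [natDegree_X])
    have h2 := P.natDegree_numPolyR_le
    have h3 := P.natDegree_denPolyR
    have h4 := sum_numDeg_add_two_le hV
    omega
  have h := Polynomial.div_tendsto_atTop_zero_of_degree_lt _ _ hdeg
  refine h.congr' (Eventually.of_forall fun t => ?_)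
  simp only [Rwp_eq_div, eval_mul, eval_X, mul_div_assoc]

/-! ### Partial fractions over `ℝ` -/

variable (P) in
/-- The real partial-fraction sum `Σ_{k ∈ poleSet} Σ_{s=1}^{q−r} B P s k (t+k)^{−s}`. [cite: Zudilin2004, §8 Lemma 19 (proof)] -/
def pfSumR (t : ℝ) : ℝ :=
  ∑ k ∈ P.poleSet, ∑ s ∈ Icc 1 (P.q - P.r), (P.B s k : ℝ) * ((t + k) ^ s)⁻¹

/-- The expansion at rational `t > −h_{r+1}`. [cite: Zudilin2004, §8 Lemma 19 (proof)] -/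
theorem Rwp_eq_pfSumR_rat (hV : P.Valid) {u : ℚ} (hu : -(P.h (P.r + 1) : ℚ) < u) : P.Rwp (u : ℝ) = P.pfSumR u := by
  have hgood : ∀ i ∈ P.poleSet, (u : ℚ) + i ≠ 0 := fun i hi => by
    have := (mem_Icc.1 hi).1
    have : (P.h (P.r + 1) : ℚ) ≤ i := by exact_mod_cast this
    exact ne_of_gt (by linarith)
  rw [← cast_RwpQ, RwpQ_eq_sum_B hV u hgood, pfSumR]
  push_cast
  rfl

/-- Smoothness of `(y+i)^{−s}` at `t` with `t + i > 0`. [cite: Zudilin2004, §8 Lemma 19 (proof)] -/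
theorem contDiffAt_inv_pow_real' (i s : ℕ) {t : ℝ} (ht : 0 < t + i) {N : WithTop ℕ∞} :
    ContDiffAt ℝ N (fun y : ℝ => ((y + i) ^ s)⁻¹) t := by
  refine ((contDiffAt_id.add contDiffAt_const).pow s).inv ?_
  simp only [id]
  exact pow_ne_zero _ ht.ne'

/-- Smoothness of the partial-fraction sum at `t > −h_{r+1}`. [cite: Zudilin2004, §8 Lemma 19 (proof)] -/
theorem contDiffAt_pfSumR {t : ℝ} (ht : -(P.h (P.r + 1) : ℝ) < t) {N : WithTop ℕ∞} :
    ContDiffAt ℝ N P.pfSumR t := by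
  unfold pfSumR
  refine ContDiffAt.sum fun k hk => ContDiffAt.sum fun s _ => ?_
  exact contDiffAt_const.mul (contDiffAt_inv_pow_real' k s (pos_of_mem_poleSet ht hk))

/-- **Partial fractions of `R` over `ℝ`**: `R(t) = Σ_{k,s} B P s k (t+k)^{−s}` for real `t > −h_{r+1}`
(from the rational identity by density of `ℚ` and continuity). [cite: Zudilin2004, §8 Lemma 19 (proof)] -/
theorem Rwp_eq_pfSumR (hV : P.Valid) {t : ℝ} (ht : -(P.h (P.r + 1) : ℝ) < t) : P.Rwp t = P.pfSumR t := by
  set f : ℝ → ℝ := fun y => P.Rwp y - P.pfSumR y with hf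
  have hfc : ContinuousAt f t := (continuousAt_Rwp hV ht).sub (contDiffAt_pfSumR ht (N := 0)).continuousAt
  haveI : (𝓝[Set.range ((↑) : ℚ → ℝ)] t).NeBot := Rat.denseRange_cast.nhdsWithin_neBot t
  have h1 : Tendsto f (𝓝[Set.range ((↑) : ℚ → ℝ)] t) (𝓝 (f t)) :=
    hfc.tendsto.mono_left nhdsWithin_le_nhds
  have h2 : f =ᶠ[𝓝[Set.range ((↑) : ℚ → ℝ)] t] fun _ => 0 := by
    have hpos : ∀ᶠ y in 𝓝[Set.range ((↑) : ℚ → ℝ)] t, -(P.h (P.r + 1) : ℝ) < y :=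
      mem_nhdsWithin_of_mem_nhds (Ioi_mem_nhds ht)
    filter_upwards [hpos, self_mem_nhdsWithin] with y hy hmem
    obtain ⟨u, rfl⟩ := hmem
    have hu : -(P.h (P.r + 1) : ℚ) < u := by exact_mod_cast hy
    simp only [hf, Rwp_eq_pfSumR_rat hV hu, sub_self]
  have := tendsto_nhds_unique (h1.congr' h2) tendsto_const_nhds
  simp only [hf] at this
  linarith

/-! ### The residues sum to zero -/

/-- `t · pfSumR t → Σ_k B P 1 k` as `t → ∞`. [cite: Zudilin2004, §8 Lemma 19 (proof)] -/
theorem tendsto_mul_pfSumR (hV : P.Valid) :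
    Tendsto (fun t : ℝ => t * P.pfSumR t) atTop (𝓝 (∑ k ∈ P.poleSet, (P.B 1 k : ℝ))) := by
  have hM : 1 ≤ P.q - P.r := by have := hV.r_add_four_le; omega
  have h : Tendsto (fun t : ℝ => ∑ k ∈ P.poleSet, ∑ s ∈ Icc 1 (P.q - P.r), (P.B s k : ℝ) * (t * ((t + k) ^ s)⁻¹))
      atTop (𝓝 (∑ k ∈ P.poleSet, ∑ s ∈ Icc 1 (P.q - P.r), (P.B s k : ℝ) * (if s = 1 then 1 else 0))) := by
    refine tendsto_finsetSum _ fun k _ => tendsto_finsetSum _ fun s hs => ?_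
    exact (tendsto_mul_inv_pow k (mem_Icc.1 hs).1).const_mul _
  have hval : ∑ k ∈ P.poleSet, ∑ s ∈ Icc 1 (P.q - P.r), (P.B s k : ℝ) * (if s = 1 then (1 : ℝ) else 0)
      = ∑ k ∈ P.poleSet, (P.B 1 k : ℝ) := by
    refine sum_congr rfl fun k _ => ?_
    simp only [mul_ite, mul_one, mul_zero]
    rw [sum_ite_eq']
    simp [hM]
  rw [hval] at h
  refine h.congr fun t => ?_
  simp only [pfSumR, mul_sum]
  exact sum_congr rfl fun k _ => sum_congr rfl fun s _ => by ring

/-- **The residues sum to zero**: `Σ_{k ∈ poleSet} B P 1 k = 0`, i.e. `ζ(r)` does not occur in `F(𝐡)`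
([Zudilin2004, proof of Lemma 19]: `A_r = 0` by (8.3)). [cite: Zudilin2004, §8 Lemma 19 (proof), (8.3)] -/
theorem sum_B_one_eq_zero (hV : P.Valid) : ∑ k ∈ P.poleSet, P.B 1 k = 0 := by
  have h1 := tendsto_mul_Rwp hV
  have h2 := tendsto_mul_pfSumR hV
  have heq : (fun t : ℝ => t * P.Rwp t) =ᶠ[atTop] fun t => t * P.pfSumR t := by
    filter_upwards [eventually_gt_atTop 0] with t ht
    rw [Rwp_eq_pfSumR hV (lt_of_le_of_lt (by simp) ht)]
  have := tendsto_nhds_unique (h1.congr' heq) h2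
  exact_mod_cast this.symm

/-! ### Higher derivatives -/

/-- `∏_{i<m} (−s − i) = (−1)^m · s(s+1)⋯(s+m−1)`. [cite: Zudilin2004, §8 Lemma 19 (proof)] -/
private theorem prod_range_neg_sub (s m : ℕ) :
    ∏ i ∈ range m, (-(s : ℝ) - i) = (-1) ^ m * (s.ascFactorial m : ℝ) := by
  induction m with
  | zero => simp
  | succ m ih =>
    rw [prod_range_succ, ih, Nat.ascFactorial_succ, pow_succ]
    push_cast
    ring

/-- `(d/dy)^m (y+i)^{−s} = (−1)^m s(s+1)⋯(s+m−1) (y+i)^{−s−m}` at `y = t` (with Mathlib's conventions for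
`deriv` this needs no hypothesis on `t`; it is used at `t + i > 0`). [cite: Zudilin2004, §8 Lemma 19 (proof)] -/
theorem iteratedDeriv_inv_pow (m i s : ℕ) (t : ℝ) :
    iteratedDeriv m (fun y : ℝ => ((y + i) ^ s)⁻¹) t
      = (-1) ^ m * (s.ascFactorial m : ℝ) * ((t + i) ^ (s + m))⁻¹ := by
  have hfun : (fun y : ℝ => ((y + i) ^ s)⁻¹) = fun y => (fun x : ℝ => x ^ (-(s : ℤ))) (y + i) := by
    funext y
    simp only [zpow_neg, zpow_natCast]
  rw [hfun, iteratedDeriv_comp_add_const m (fun x : ℝ => x ^ (-(s : ℤ))) (i : ℝ)]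
  simp only
  rw [iteratedDeriv_eq_iterate, iter_deriv_zpow]
  rw [show (-(s : ℤ) - (m : ℕ)) = -((s + m : ℕ) : ℤ) by push_cast; ring, zpow_neg, zpow_natCast]
  congr 1
  have := prod_range_neg_sub s m
  push_cast at this ⊢
  exact this

/-- **`R^{(m)}(t)` through the partial fractions**: for real `t > −h_{r+1}`,
`R^{(m)}(t) = Σ_{k,s} B P s k · (−1)^m s(s+1)⋯(s+m−1) · (t+k)^{−s−m}`. [cite: Zudilin2004, §8 Lemma 19 (proof)] -/
theorem iteratedDeriv_Rwp (hV : P.Valid) {t : ℝ} (ht : -(P.h (P.r + 1) : ℝ) < t) (m : ℕ) :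
    iteratedDeriv m P.Rwp t = ∑ k ∈ P.poleSet, ∑ s ∈ Icc 1 (P.q - P.r),
      (P.B s k : ℝ) * ((-1) ^ m * (s.ascFactorial m : ℝ)) * ((t + k) ^ (s + m))⁻¹ := by
  have heq : P.Rwp =ᶠ[𝓝 t] P.pfSumR :=
    Filter.eventuallyEq_of_mem (Ioi_mem_nhds ht) fun y hy => Rwp_eq_pfSumR hV hy
  rw [heq.iteratedDeriv_eq]
  unfold pfSumR
  rw [iteratedDeriv_fun_sum fun k hk => ContDiffAt.sum fun s _ =>
    contDiffAt_const.mul (contDiffAt_inv_pow_real' k s (pos_of_mem_poleSet ht hk))]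
  refine sum_congr rfl fun k hk => ?_
  rw [iteratedDeriv_fun_sum fun s _ =>
    contDiffAt_const.mul (contDiffAt_inv_pow_real' k s (pos_of_mem_poleSet ht hk))]
  refine sum_congr rfl fun s _ => ?_
  rw [iteratedDeriv_const_mul _ (contDiffAt_inv_pow_real' k s (pos_of_mem_poleSet ht hk)),
    iteratedDeriv_inv_pow m k s t]
  ring

/-! ### A telescoping series -/

/-- For `f ↘ 0`: `Σ_n (f(n) − f(n+d)) = Σ_{n<d} f(n)` (a series of non-negative terms).
[cite: Zudilin2004, §8 Lemma 19 (proof)] -/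
theorem hasSum_sub_shift {f : ℕ → ℝ} (hf : Tendsto f atTop (𝓝 0)) (hmono : Antitone f) (d : ℕ) :
    HasSum (fun n => f n - f (n + d)) (∑ n ∈ range d, f n) := by
  have hnonneg : ∀ n, 0 ≤ f n - f (n + d) := fun n => sub_nonneg.2 (hmono (Nat.le_add_right n d))
  refine (hasSum_iff_tendsto_nat_of_nonneg hnonneg _).2 ?_
  have hpartial : ∀ N, ∑ n ∈ range N, (f n - f (n + d)) = ∑ n ∈ range d, f n - ∑ n ∈ range d, f (N + n) := by
    intro N
    induction N with
    | zero => simp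
    | succ N ih =>
      rw [sum_range_succ, ih]
      have e1 := sum_range_succ (fun n => f (N + n)) d
      have e2 := sum_range_succ' (fun n => f (N + n)) d
      have e3 : ∑ n ∈ range d, f (N + (n + 1)) = ∑ n ∈ range d, f (N + 1 + n) :=
        sum_congr rfl fun n _ => by rw [show N + (n + 1) = N + 1 + n by ring]
      simp only [add_zero] at e2
      rw [e3] at e2
      linarith
  simp_rw [hpartial]
  have htail : Tendsto (fun N => ∑ n ∈ range d, f (N + n)) atTop (𝓝 0) := by
    have : Tendsto (fun N => ∑ n ∈ range d, f (N + n)) atTop (𝓝 (∑ n ∈ range d, (0 : ℝ))) :=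
      tendsto_finsetSum _ fun n _ => hf.comp (tendsto_add_atTop_nat n)
    simpa using this
  simpa using (tendsto_const_nhds (x := ∑ n ∈ range d, f n)).sub htail

/-- `Σ_{n<d} (n+1+c₀)^{−e} = H_{c₀+d}^{(e)} − H_{c₀}^{(e)}`. [cite: Zudilin2004, §8 Lemma 19 (proof)] -/
theorem sum_range_inv_pow_eq_Hsum_sub (c₀ d e : ℕ) :
    ∑ n ∈ range d, (((n : ℝ) + 1 + c₀) ^ e)⁻¹ = (Hsum (c₀ + d) e : ℝ) - (Hsum c₀ e : ℝ) := by
  induction d with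
  | zero => simp
  | succ d ih =>
    rw [sum_range_succ, ih]
    unfold Hsum
    rw [show c₀ + (d + 1) = (c₀ + d) + 1 by ring, Finset.sum_Icc_succ_top (by omega)]
    push_cast
    ring

/-- The `s = 1` telescoping series at a pole `k`: with `t_n = n + 1 − h₁`, `k₀ = h_{r+1} ≤ k`, `e ≥ 1`,
`Σ_n ((t_n+k)^{−e} − (t_n+k₀)^{−e}) = −(H_{k−h₁}^{(e)} − H_{k₀−h₁}^{(e)})`. [cite: Zudilin2004, §8 Lemma 19 (proof)] -/
theorem hasSum_sOne (hV : P.Valid) {k : ℕ} (hk : k ∈ P.poleSet) {e : ℕ} (he : 1 ≤ e) :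
    HasSum (fun n : ℕ => ((((n : ℝ) + 1 - P.h 1 + k) ^ e))⁻¹ - ((((n : ℝ) + 1 - P.h 1 + P.h (P.r + 1)) ^ e))⁻¹)
      (-((Hsum (k - P.h 1) e : ℝ) - (Hsum (P.h (P.r + 1) - P.h 1) e : ℝ))) := by
  have hrq := hV.r_add_four_le
  have hk' := mem_Icc.1 hk
  have h1r : P.h 1 ≤ P.h (P.r + 1) := hV.h_mono le_rfl (by omega) (by omega)
  set c₀ : ℕ := P.h (P.r + 1) - P.h 1 with hc₀
  set d : ℕ := k - P.h (P.r + 1) with hd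
  have hbase : ∀ n : ℕ, (n : ℝ) + 1 - P.h 1 + P.h (P.r + 1) = (n : ℝ) + 1 + c₀ := by
    intro n; rw [hc₀, Nat.cast_sub h1r]; ring
  set f : ℕ → ℝ := fun n => (((n : ℝ) + 1 + c₀) ^ e)⁻¹ with hf
  have hfpos : ∀ n : ℕ, 0 < (n : ℝ) + 1 + c₀ := fun n => by positivity
  have hmono : Antitone f := by
    intro a b hab
    simp only [hf]
    refine inv_anti₀ (pow_pos (hfpos a) e) (pow_le_pow_left₀ (hfpos a).le ?_ e)
    have : (a : ℝ) ≤ b := by exact_mod_cast hab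
    linarith
  have hlim : Tendsto f atTop (𝓝 0) := by
    have hb : Tendsto (fun n : ℕ => (n : ℝ) + 1 + c₀) atTop atTop := by
      have := tendsto_atTop_add_const_right atTop ((1 : ℝ) + c₀) tendsto_natCast_atTop_atTop
      exact this.congr fun n => by ring
    have := ((tendsto_pow_atTop (by omega : e ≠ 0)).comp hb).inv_tendsto_atTop
    exact this.congr fun n => by simp [hf, Function.comp_def]
  have h := (hasSum_sub_shift hlim hmono d).neg
  have hsum : ∑ n ∈ range d, f n = (Hsum (k - P.h 1) e : ℝ) - (Hsum (P.h (P.r + 1) - P.h 1) e : ℝ) := by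
    simp only [hf]
    rw [sum_range_inv_pow_eq_Hsum_sub, hc₀, hd, show P.h (P.r + 1) - P.h 1 + (k - P.h (P.r + 1)) = k - P.h 1 by omega]
  rw [hsum] at h
  have hfun : (fun n : ℕ => ((((n : ℝ) + 1 - P.h 1 + k) ^ e))⁻¹ - ((((n : ℝ) + 1 - P.h 1 + P.h (P.r + 1)) ^ e))⁻¹)
      = fun n => -(f n - f (n + d)) := by
    funext n
    simp only [hf, neg_sub]
    rw [hbase n, show ((n + d : ℕ) : ℝ) + 1 + c₀ = (n : ℝ) + 1 - P.h 1 + k by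
      simp only [hd, hc₀]; push_cast [Nat.cast_sub hk'.1, Nat.cast_sub h1r]; ring]
  rw [hfun]
  exact h

/-! ### The linear form -/

variable (P) in
/-- The coefficient of `ζ(s+r−1)` in `F(𝐡)`: `C(s+r−2, r−1) Σ_k B P s k` (`A_{j−1}` of (8.12), `j = s + r`).
[cite: Zudilin2004, §8 (8.12)] -/
def qZeta (s : ℕ) : ℚ := ((s + P.r - 2).choose (P.r - 1) : ℚ) * ∑ k ∈ P.poleSet, P.B s k

variable (P) in
/-- The constant term of `F(𝐡)`: `−Σ_k Σ_{s=1}^{q−r} C(s+r−2, r−1) B P s k H_{k−h₁}^{(s+r−1)}` (`−A_0` of the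
printed proof). [cite: Zudilin2004, §8 Lemma 19 (proof)] -/
def qConst : ℚ :=
  -∑ k ∈ P.poleSet, ∑ s ∈ Icc 1 (P.q - P.r),
    ((s + P.r - 2).choose (P.r - 1) : ℚ) * P.B s k * Hsum (k - P.h 1) (s + P.r - 1)

/-- `qZeta P 1 = 0` (residues) and `qZeta P s = 0` for even `s` (symmetry). [cite: Zudilin2004, §8 Lemma 19 (proof)] -/
theorem qZeta_eq_zero (hV : P.Valid) {s : ℕ} (hs : s ≤ P.q - P.r) (h : s = 1 ∨ Even s) : P.qZeta s = 0 := by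
  unfold qZeta
  rcases h with rfl | heven
  · rw [sum_B_one_eq_zero hV, mul_zero]
  · rw [sum_B_eq_zero_of_even hV hs heven, mul_zero]

/-- **`F(𝐡)` as a linear form** ([Zudilin2004, Lemma 19, first part], uniform in odd `r ≥ 1`):
`F(𝐡) = Σ_{s=2}^{q−r} qZeta P s · ζ(s+r−1) + qConst P`. [cite: Zudilin2004, §8 Lemma 19, (8.12)] -/
theorem Fwp_eq (hV : P.Valid) :
    P.Fwp = ∑ s ∈ Icc 2 (P.q - P.r), (P.qZeta s : ℝ) * zetaValue (s + P.r - 1) + (P.qConst : ℝ) := by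
  have hrq := hV.r_add_four_le
  have hr1 := hV.one_le_r
  have h1r : P.h 1 ≤ P.h (P.r + 1) := hV.h_mono le_rfl (by omega) (by omega)
  have hk₀ : P.h (P.r + 1) ∈ P.poleSet := by
    have := hV.two_mul_h_lt (j := P.r + 1) (by omega) (by omega)
    exact mem_Icc.2 ⟨le_rfl, by omega⟩
  -- abbreviations (all written out: `m = r − 1`, `M = q − r`, `k₀ = h_{r+1}`)
  set tn : ℕ → ℝ := fun n => (n : ℝ) + 1 - P.h 1 with htn
  have htn_gt : ∀ n : ℕ, -(P.h (P.r + 1) : ℝ) < tn n := by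
    intro n
    have : (P.h 1 : ℝ) ≤ P.h (P.r + 1) := by exact_mod_cast h1r
    simp only [htn]
    have : (0 : ℝ) ≤ n := Nat.cast_nonneg n
    linarith
  set cR : ℕ → ℝ := fun s => (-1) ^ (P.r - 1) * (s.ascFactorial (P.r - 1) : ℝ) with hcR
  set β : ℕ → ℕ → ℝ := fun s k => (P.B s k : ℝ) with hβ
  set x : ℕ → ℕ → ℕ → ℝ := fun n k s => ((tn n + k) ^ (s + (P.r - 1)))⁻¹ with hx
  have hB1 : ∑ k ∈ P.poleSet, β 1 k = 0 := by
    simp only [hβ]; exact_mod_cast sum_B_one_eq_zero hV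
  -- the summand
  have hIcc : Icc 1 (P.q - P.r) = insert 1 (Icc 2 (P.q - P.r)) := by
    ext s; simp only [mem_Icc, mem_insert]; omega
  have hnot : 1 ∉ Icc 2 (P.q - P.r) := by simp
  set g : ℕ → ℝ := fun n => ∑ k ∈ P.poleSet, (β 1 k * cR 1 * (x n k 1 - x n (P.h (P.r + 1)) 1) +
    ∑ s ∈ Icc 2 (P.q - P.r), β s k * cR s * x n k s) with hg
  have hfg : ∀ n : ℕ, iteratedDeriv (P.r - 1) P.Rwp (tn n) = g n := by
    intro n
    rw [iteratedDeriv_Rwp hV (htn_gt n) (P.r - 1)]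
    simp only [hIcc, sum_insert hnot, hg]
    have h0 : ∑ k ∈ P.poleSet, β 1 k * cR 1 * x n (P.h (P.r + 1)) 1 = 0 := by
      rw [← sum_mul, ← sum_mul, hB1, zero_mul, zero_mul]
    rw [← add_zero (∑ k ∈ P.poleSet, (β 1 k * cR 1 * (x n k 1 - x n (P.h (P.r + 1)) 1) +
      ∑ s ∈ Icc 2 (P.q - P.r), β s k * cR s * x n k s)), ← h0, ← sum_add_distrib]
    exact sum_congr rfl fun k _ => by ring
  -- the pieces' sums
  have hS2 : ∀ k ∈ P.poleSet, ∀ s ∈ Icc 2 (P.q - P.r),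
      HasSum (fun n => x n k s) (zetaValue (s + (P.r - 1)) - (Hsum (k - P.h 1) (s + (P.r - 1)) : ℝ)) := by
    intro k hk s hs
    have hk1 : P.h 1 ≤ k := h1r.trans (mem_Icc.1 hk).1
    have h := hasSum_inv_pow_shift (k - P.h 1) (m := s + (P.r - 1)) (by have := mem_Icc.1 hs; omega)
    convert h using 2 with n
    simp only [hx, htn]
    rw [Nat.cast_sub hk1]
    ring
  have hS1 : ∀ k ∈ P.poleSet, HasSum (fun n => x n k 1 - x n (P.h (P.r + 1)) 1)
      (-((Hsum (k - P.h 1) (1 + (P.r - 1)) : ℝ) - (Hsum (P.h (P.r + 1) - P.h 1) (1 + (P.r - 1)) : ℝ))) := by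
    intro k hk
    have h := hasSum_sOne hV hk (e := 1 + (P.r - 1)) (by omega)
    simpa only [hx, htn] using h
  have hgsum : HasSum g (∑ k ∈ P.poleSet, (β 1 k * cR 1 *
      (-((Hsum (k - P.h 1) (1 + (P.r - 1)) : ℝ) - (Hsum (P.h (P.r + 1) - P.h 1) (1 + (P.r - 1)) : ℝ))) +
      ∑ s ∈ Icc 2 (P.q - P.r), β s k * cR s *
        (zetaValue (s + (P.r - 1)) - (Hsum (k - P.h 1) (s + (P.r - 1)) : ℝ)))) := by
    refine hasSum_sum fun k hk => HasSum.add ((hS1 k hk).mul_left _) (hasSum_sum fun s hs => ?_)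
    exact (hS2 k hk s hs).mul_left _
  have hfun : (fun n : ℕ => iteratedDeriv (P.r - 1) (Rwp P) ((n : ℝ) + 1 - P.h 1)) = g := funext hfg
  unfold Fwp
  rw [hfun, hgsum.tsum_eq]
  -- the binomial coefficients
  have hC : ∀ s, 1 ≤ s → (1 / ((P.r - 1)! : ℝ)) * cR s = (((s + P.r - 2).choose (P.r - 1) : ℕ) : ℝ) := by
    intro s hs
    simp only [hcR]
    rw [hV.even_r_sub_one.neg_one_pow, one_mul, Nat.ascFactorial_eq_factorial_mul_choose',
      show s + (P.r - 1) - 1 = s + P.r - 2 by omega]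
    have hm0 : ((P.r - 1)! : ℝ) ≠ 0 := by positivity
    push_cast
    field_simp
  have e1 : ∀ s, s + (P.r - 1) = s + P.r - 1 := fun s => by omega
  simp only [e1]
  -- left-hand side, expanded
  have lhs : (1 / ((P.r - 1)! : ℝ)) * ∑ k ∈ P.poleSet, (β 1 k * cR 1 *
      (-((Hsum (k - P.h 1) (1 + P.r - 1) : ℝ) - (Hsum (P.h (P.r + 1) - P.h 1) (1 + P.r - 1) : ℝ))) +
      ∑ s ∈ Icc 2 (P.q - P.r), β s k * cR s *
        (zetaValue (s + P.r - 1) - (Hsum (k - P.h 1) (s + P.r - 1) : ℝ)))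
      = ∑ k ∈ P.poleSet, ∑ s ∈ Icc 2 (P.q - P.r),
          (((s + P.r - 2).choose (P.r - 1) : ℕ) : ℝ) * β s k * zetaValue (s + P.r - 1)
        - ∑ k ∈ P.poleSet, ((((1 + P.r - 2).choose (P.r - 1) : ℕ) : ℝ) * β 1 k *
            (Hsum (k - P.h 1) (1 + P.r - 1) : ℝ)
          + ∑ s ∈ Icc 2 (P.q - P.r), (((s + P.r - 2).choose (P.r - 1) : ℕ) : ℝ) * β s k *
            (Hsum (k - P.h 1) (s + P.r - 1) : ℝ))
        + (((1 + P.r - 2).choose (P.r - 1) : ℕ) : ℝ) * (Hsum (P.h (P.r + 1) - P.h 1) (1 + P.r - 1) : ℝ) *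
          ∑ k ∈ P.poleSet, β 1 k := by
    rw [mul_sum, mul_sum, ← sum_sub_distrib, ← sum_add_distrib]
    refine sum_congr rfl fun k _ => ?_
    rw [mul_add, mul_sum]
    have t1 : (1 / ((P.r - 1)! : ℝ)) * (β 1 k * cR 1 *
        (-((Hsum (k - P.h 1) (1 + P.r - 1) : ℝ) - (Hsum (P.h (P.r + 1) - P.h 1) (1 + P.r - 1) : ℝ))))
        = (((1 + P.r - 2).choose (P.r - 1) : ℕ) : ℝ) * β 1 k *
          (-((Hsum (k - P.h 1) (1 + P.r - 1) : ℝ) - (Hsum (P.h (P.r + 1) - P.h 1) (1 + P.r - 1) : ℝ))) := by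
      rw [← hC 1 le_rfl]; ring
    have t2 : ∀ s ∈ Icc 2 (P.q - P.r), (1 / ((P.r - 1)! : ℝ)) * (β s k * cR s *
        (zetaValue (s + P.r - 1) - (Hsum (k - P.h 1) (s + P.r - 1) : ℝ)))
        = (((s + P.r - 2).choose (P.r - 1) : ℕ) : ℝ) * β s k * zetaValue (s + P.r - 1)
          - (((s + P.r - 2).choose (P.r - 1) : ℕ) : ℝ) * β s k * (Hsum (k - P.h 1) (s + P.r - 1) : ℝ) := by
      intro s hs
      rw [← hC s (by have := mem_Icc.1 hs; omega)]; ring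
    rw [t1, sum_congr rfl t2, sum_sub_distrib]
    ring
  -- right-hand side, expanded
  have rhs : ∑ s ∈ Icc 2 (P.q - P.r), (P.qZeta s : ℝ) * zetaValue (s + P.r - 1) + (P.qConst : ℝ)
      = ∑ k ∈ P.poleSet, ∑ s ∈ Icc 2 (P.q - P.r),
          (((s + P.r - 2).choose (P.r - 1) : ℕ) : ℝ) * β s k * zetaValue (s + P.r - 1)
        - ∑ k ∈ P.poleSet, ((((1 + P.r - 2).choose (P.r - 1) : ℕ) : ℝ) * β 1 k *
            (Hsum (k - P.h 1) (1 + P.r - 1) : ℝ)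
          + ∑ s ∈ Icc 2 (P.q - P.r), (((s + P.r - 2).choose (P.r - 1) : ℕ) : ℝ) * β s k *
            (Hsum (k - P.h 1) (s + P.r - 1) : ℝ)) := by
    have hz : ∑ s ∈ Icc 2 (P.q - P.r), (P.qZeta s : ℝ) * zetaValue (s + P.r - 1)
        = ∑ k ∈ P.poleSet, ∑ s ∈ Icc 2 (P.q - P.r),
          (((s + P.r - 2).choose (P.r - 1) : ℕ) : ℝ) * β s k * zetaValue (s + P.r - 1) := by
      simp only [qZeta, hβ]
      push_cast
      have : ∀ s ∈ Icc 2 (P.q - P.r),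
          ((((s + P.r - 2).choose (P.r - 1) : ℕ) : ℝ) * ∑ k ∈ P.poleSet, (P.B s k : ℝ)) * zetaValue (s + P.r - 1)
          = ∑ k ∈ P.poleSet, (((s + P.r - 2).choose (P.r - 1) : ℕ) : ℝ) * (P.B s k : ℝ) * zetaValue (s + P.r - 1) := by
        intro s _
        rw [mul_sum, sum_mul]
      rw [sum_congr rfl this, sum_comm]
    have hc : (P.qConst : ℝ) = -∑ k ∈ P.poleSet, ((((1 + P.r - 2).choose (P.r - 1) : ℕ) : ℝ) * β 1 k *
            (Hsum (k - P.h 1) (1 + P.r - 1) : ℝ)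
          + ∑ s ∈ Icc 2 (P.q - P.r), (((s + P.r - 2).choose (P.r - 1) : ℕ) : ℝ) * β s k *
            (Hsum (k - P.h 1) (s + P.r - 1) : ℝ)) := by
      simp only [qConst, hβ, hIcc, sum_insert hnot, Rat.cast_neg, Rat.cast_sum]
      push_cast
      rfl
    rw [hz, hc]
    ring
  rw [lhs, rhs, hB1, mul_zero, add_zero]

end HParams

end Literature.NumberTheory.Irrationality.Zudilin2004
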